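import Literature.AlgebraicGeometry.AbelianSchemes.AbelianSchemeFibreFrobeniusTwist
import Literature.AlgebraicGeometry.AbelianSchemes.AbelianSchemeFibreHom
import HarnessLib

/-!
# The conjugate ∕ Frobenius-moved fibre of an abelian scheme WITH ITS STRUCTURES: naturality of the fibre
# identifications in the abelian scheme (Milne, *Shimura varieties* §14 «`σ(A, i, λ, ηK) = (σA, σi, σλ, σηK)`»;
# Shimura 1998 §18.6 «`π ∘ β = β^f ∘ π`»; Milne, *Étale cohomology* VI Rem. 13.5)

Topic `AlgebraicGeometry/AbelianSchemes`; namespace `Literature.AlgebraicGeometry.AbelianSchemes.AbelianSchemeOver`.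
KERNEL ONLY: theorems; **no definition, no named fact, no instance, no notation, no `sorry`**.  Cell `pub/hodgecm-mathlib`,
programme P6 («MOD»), piece (d2) of the (d1) lineage (★ `AbelianSchemeFibreFrobeniusTwist`: the VARIETY
`A_{x ≫ F_S} ≅ (A_x)^{(q)}` and the LEVEL SECTIONS `τ(x ≫ F_S) ↦ F_{A_x/L}(τ(x))`); this file adds the HOMOMORPHISMS,
i.e. the endomorphism structure `ι` and the polarisation `λ : A → Â` of a moduli tuple `(A, ι, λ, η)` read on
geometric fibres through ★ `fibreHom` — the (n5)∕(o-c3) «Frobenius-twist reading» consumed by the pointwise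
dictionary DICT (c3a) of the door P″.

## Mathematics

Let `A, B` be abelian schemes over a base `S₀`, `f : A → B` a homomorphism of `S₀`-group schemes, `L` a field,
`s : Spec L → S₀` and `σ` a ring automorphism of `L`.  The fibre identification `(A_s)^σ ≅ A_{Spec σ ≫ s}`
(★ `conjFibreIso`, transitivity of base change [GortzWedhorn2020, Prop. 4.16]) is the component at `A` of a natural
isomorphism of functors `Over.pullback s ⋙ Over.pullback (Spec σ) ≅ Over.pullback (Spec σ ≫ s)` lifted to group
objects, hence NATURAL IN THE ABELIAN SCHEME: the square
`(f_s)^σ ≫ e_B = e_A ≫ f_{Spec σ ≫ s}` commutes (§1).  This is Milne's «`σ(A, i, λ, ηK) = (σA, σi, σλ, σηK)`»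
([Milne2005ShimuraVarieties, §14 pp. 124–125]) for the endomorphisms `i(a)` and the polarisation `λ : A → Â`
(both homomorphisms of abelian schemes, `Â = D.hat` an abelian scheme over `S₀` in the tree's ★ `DualPair`), read on
the fibres of ONE family `A → S₀` at the two points `s` and `Spec σ ≫ s`.

For `S` a scheme over a finite field `k` with `#k = q = p^r`, `A, B` abelian schemes over `S`, `L ⊇ k` perfect and
`x : Spec L → S` over `k`, the `q`-Frobenius moves `x` to `x ≫ F_S = Spec(Frob^r) ≫ x`, and the Frobenius twist
over a perfect field IS the conjugate by `Frob^r` (★ `frobeniusTwist_eq_conjugate`, `Hom.frobeniusTwist_eq_conjugate`,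
both `rfl`); so §1 composed with the transport along the equality of points gives (§2)
**`f_{x ≫ F_S} ≫ e_B = e_A ≫ f_x^{(q)}`** for the (d1) isomorphisms `e = fibreFrobeniusTwistIso`
— Shimura's «`β^f`» ([Shimura1998, §18.6 p. 127]) at the moved point.  Together with (d1) this says: the fibre
of `(A, ι, λ, η)` at `F(x̄)` is `(A_x̄^{(q)}, ι^{(q)}, λ^{(q)}, F_{A_x̄/L} ∘ η_x̄)`, and ★ `relFrobenius_comp`
(`F_{A/L} ≫ f^{(q)} = f ≫ F_{B/L}`) makes `F_{A_x̄/L}` a morphism of tuples — the Eichler–Shimura ∕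
congruence-relation input [Milne2025, VI §13 Rem. 13.5].

## Contents
* §1 (any base `S₀`, any ring automorphism `σ` of `L`): `fibreHom_comp_fibreCongrPtIso_hom` (transport along an
  equality of points is natural), **`conjugate_fibreHom_comp_conjFibreIso_hom`** (naturality of ★ `conjFibreIso`),
  its inverse form `fibreHom_comp_conjFibreIso_inv`, the endomorphism form `fibreHom_specTwist_eq_conj`, the points
  form, and the def-free natural packaging `exists_iso_conjugate_fibre_natural` (refining ★
  `exists_iso_conjugate_fibre_map_conjPoints_restrictPt` by the homomorphism square);
* §2 (`S : SchemeOver k`, `k` finite, `#k = p^r`, `L` perfect): **`fibreHom_comp_fibreFrobeniusTwistIso_hom`**, the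
  inverse form, the endomorphism form `fibreHom_frobeniusOver_eq_conj` (for `ι(a)`), the points form, and the def-free
  packaging `exists_iso_fibre_frobeniusOver_natural` (ONE family of isomorphisms `e_A`, natural in `A`, carrying
  sections to `F_{A_x/L}` of sections).

HC_CM is proved only modulo the printed citations until rung 0 closes; this file changes no count.

## References
* [Milne2005ShimuraVarieties] J. S. Milne, *Introduction to Shimura varieties* (2005/2017), §11 p. 108 («the functor
  `V ↦ σV`, `α ↦ σα`»), §14 pp. 124–125 («`σ(A, i, λ, ηK) = (σA, σi, σλ, σηK)`»).
* [Shimura1998] G. Shimura, *Abelian varieties with complex multiplication and modular functions*, §18.6 proof of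
  Thm. 18.6, pp. 127–128 («`β^f`», «`π ∘ β = β^f ∘ π`», «`(t^σ)~ = π(t̃)`»).
* [Milne2025] J. S. Milne, *Étale cohomology*, VI §13 Rem. 13.5 (`X^{(q)}`, `F_{X/k}`).
* [GortzWedhorn2020] U. Görtz, T. Wedhorn, *Algebraic Geometry I* (2nd ed.), Section (4.7), Prop. 4.16 (transitivity of
  base change), Remark 16.54 (base change of group schemes).
* [MumfordFogartyKirwan1994] D. Mumford, J. Fogarty, F. Kirwan, *GIT* (3rd ed.), Ch. 6 §2 Def. 6.3 (p. 120) (the induced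
  `λ̄ : X̄ → X̂̄` on geometric fibres), Ch. 7 §2 Def. 7.1 (p. 129).
-/

set_option autoImplicit false

noncomputable section

-- `(specOver k L).left = Spec L`, `bcSpec L (AlongHom L σ) = specTwist σ`, `A.frobeniusTwist p r = A.conjugate (Frob^r)`
-- are definitional only above `instances` transparency (as in ★ `AbelianSchemeOverFibreConjugate`,
-- ★ `AbelianSchemeFibreFrobeniusTwist`, ★ `Motives/AbelianVarietyFrobeniusTwistVariety`).
set_option backward.isDefEq.respectTransparency false

universe u

open CategoryTheory CategoryTheory.Limits AlgebraicGeometry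

namespace Literature.AlgebraicGeometry.AbelianSchemes

namespace AbelianSchemeOver

open Literature.AlgebraicGeometry.Motives Literature.AlgebraicGeometry.GroupSchemes
open Literature.AlgebraicGeometry.Limits

/-! ## §1 Naturality of the conjugate-fibre identification in the abelian scheme -/

section Conjugate

variable {S₀ : Scheme.{u}} {A B : AbelianSchemeOver S₀} {L : Type u} [Field L] (σ : L ≃+* L)
  (s : Spec (.of L) ⟶ S₀)

/-- Transport of the fibre along an EQUALITY of base points (★ `fibreCongrPtIso`, an `eqToIso`) is natural in the
abelian scheme: `f_{s₁} ≫ e_B = e_A ≫ f_{s₂}`. [cite: GortzWedhorn2020, Section (4.7), Prop. 4.16] -/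
theorem fibreHom_comp_fibreCongrPtIso_hom {s₁ s₂ : Spec (.of L) ⟶ S₀} (h : s₁ = s₂) (f : A.X ⟶ B.X) [IsMonHom f] :
    fibreHom f s₁ ≫ (B.fibreCongrPtIso h).hom = (A.fibreCongrPtIso h).hom ≫ fibreHom f s₂ := by
  subst h
  simp only [fibreCongrPtIso, eqToIso_refl, Iso.refl_hom, Category.comp_id, Category.id_comp]

/-- **Naturality of `conjFibreIso` in the abelian scheme — Milne's «`σ(A, i, λ, ηK) = (σA, σi, σλ, σηK)`» for the
homomorphisms.**  For a homomorphism `f : A → B` of abelian schemes over `S₀` (`[IsMonHom f]`; e.g. an endomorphism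
`i(a)`, or a polarisation `λ : A → Â` with `B = D.hat`), the conjugate `(f_s)^σ` of its fibre at `s` and its fibre at the
twisted point `Spec σ ≫ s` correspond under the identifications `(A_s)^σ ≅ A_{Spec σ ≫ s}`, `(B_s)^σ ≅ B_{Spec σ ≫ s}`:
`(f_s)^σ ≫ e_B = e_A ≫ f_{Spec σ ≫ s}` (both sides are the images of `f` under the two base-change functors of ★
`pullbackFacIso`, and `conjFibreIso` is its component; ★ `pullbackFacObjIso_naturality`).
[cite: Milne2005ShimuraVarieties, §14 pp. 124–125] [cite: GortzWedhorn2020, Section (4.7), Prop. 4.16 and Remark 16.54] -/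
theorem conjugate_fibreHom_comp_conjFibreIso_hom (f : A.X ⟶ B.X) [IsMonHom f] :
    AbelianVariety.Hom.conjugate σ (fibreHom f s) ≫ (B.conjFibreIso σ s).hom =
      (A.conjFibreIso σ s).hom ≫ fibreHom f (specTwist σ ≫ s) := by
  apply AbelianVariety.hom_ext
  change (AbelianVariety.Hom.conjugate σ (fibreHom f s)).hom.hom.hom ≫ (B.conjFibreIso σ s).hom.hom.hom.hom =
    (A.conjFibreIso σ s).hom.hom.hom.hom ≫ (fibreHom f (specTwist σ ≫ s)).hom.hom.hom
  rw [conjFibreIso_hom_hom_hom_hom, conjFibreIso_hom_hom_hom_hom, fibreHom_hom_hom_hom]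
  exact pullbackFacObjIso_naturality s (specTwist σ) (specTwist σ ≫ s) rfl f

/-- Inverse form of the naturality square: `f_{Spec σ ≫ s} ≫ e_B⁻¹ = e_A⁻¹ ≫ (f_s)^σ`.
[cite: Milne2005ShimuraVarieties, §14 pp. 124–125] -/
theorem fibreHom_comp_conjFibreIso_inv (f : A.X ⟶ B.X) [IsMonHom f] :
    fibreHom f (specTwist σ ≫ s) ≫ (B.conjFibreIso σ s).inv =
      (A.conjFibreIso σ s).inv ≫ AbelianVariety.Hom.conjugate σ (fibreHom f s) := by
  rw [Iso.comp_inv_eq, Category.assoc, Iso.eq_inv_comp, conjugate_fibreHom_comp_conjFibreIso_hom]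

/-- **Endomorphism form** (the structure `σi` of `σA`): for an endomorphism `g` of the abelian scheme `A` (e.g. `g = i(a)`
of an `𝒪`-action), its fibre at the twisted point is the `σ`-conjugate of its fibre at `s`, transported:
`g_{Spec σ ≫ s} = e_A⁻¹ ≫ (g_s)^σ ≫ e_A`. [cite: Milne2005ShimuraVarieties, §14 pp. 124–125]
[cite: Shimura1998, §18.6 proof of Thm. 18.6, p. 127] -/
theorem fibreHom_specTwist_eq_conj (g : A.X ⟶ A.X) [IsMonHom g] :
    fibreHom g (specTwist σ ≫ s) =
      (A.conjFibreIso σ s).inv ≫ AbelianVariety.Hom.conjugate σ (fibreHom g s) ≫ (A.conjFibreIso σ s).hom := by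
  rw [Iso.eq_inv_comp, conjugate_fibreHom_comp_conjFibreIso_hom]

/-- **Points form**: for an `L`-point `P` of the fibre `A_s`, `e_B((f_s(P))^σ) = f_{Spec σ ≫ s}(e_A(P^σ))` (★ `conjPoints`
the conjugation of points, ★ `conjPoints_map` its naturality; Shimura's «`r(w)^σ`»).
[cite: Milne2005ShimuraVarieties, §11 p. 108] [cite: Shimura1998, §18.6 proof of Thm. 18.6, p. 128] -/
theorem map_conjFibreIso_conjPoints_map_fibreHom (f : A.X ⟶ B.X) [IsMonHom f] (P : (A.fibre s).toAbelianVariety.Points L) :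
    AlgPoints.map (B.conjFibreIso σ s).hom.hom.hom.hom
        ((B.fibre s).toAbelianVariety.conjPoints σ (AlgPoints.map (fibreHom f s).hom.hom.hom P)) =
      AlgPoints.map (fibreHom f (specTwist σ ≫ s)).hom.hom.hom
        (AlgPoints.map (A.conjFibreIso σ s).hom.hom.hom.hom ((A.fibre s).toAbelianVariety.conjPoints σ P)) := by
  rw [AbelianVariety.conjPoints_map]
  change ((A.fibre s).toAbelianVariety.conjPoints σ P ≫ (AbelianVariety.Hom.conjugate σ (fibreHom f s)).hom.hom.hom) ≫
      (B.conjFibreIso σ s).hom.hom.hom.hom =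
    ((A.fibre s).toAbelianVariety.conjPoints σ P ≫ (A.conjFibreIso σ s).hom.hom.hom.hom) ≫
      (fibreHom f (specTwist σ ≫ s)).hom.hom.hom
  have h := congrArg (fun φ => φ.hom.hom.hom) (conjugate_fibreHom_comp_conjFibreIso_hom σ s f)
  simp only [AbelianVariety.comp_hom] at h
  rw [Category.assoc, Category.assoc]
  exact congrArg (fun ψ => (A.fibre s).toAbelianVariety.conjPoints σ P ≫ ψ) h

/-- **Def-free natural packaging for consumers** (refines ★ `exists_iso_conjugate_fibre_map_conjPoints_restrictPt`): there
is ONE family of isomorphisms `e_A : (A_s)^σ ≅ A_{Spec σ ≫ s}`, indexed by the abelian schemes `A` over `S₀`, carrying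
conjugates of section values to section values at the twisted point AND natural in `A` for homomorphisms of abelian
schemes — i.e. the whole tuple `(A_s, i_s, λ_s, η_s)^σ` is `(A, i, λ, η)` at `Spec σ ≫ s`.
[cite: Milne2005ShimuraVarieties, §14 pp. 124–125] [cite: GortzWedhorn2020, Section (4.7), Prop. 4.16] -/
theorem exists_iso_conjugate_fibre_natural :
    ∃ e : ∀ A : AbelianSchemeOver S₀,
        ((A.fibre s).toAbelianVariety).conjugate σ ≅ (A.fibre (specTwist σ ≫ s)).toAbelianVariety,
      (∀ (A : AbelianSchemeOver S₀) (τ : A.Sections), AlgPoints.map (e A).hom.hom.hom.hom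
          ((A.fibre s).toAbelianVariety.conjPoints σ (A.restrictPt s τ)) = A.restrictPt (specTwist σ ≫ s) τ) ∧
      ∀ (A B : AbelianSchemeOver S₀) (f : A.X ⟶ B.X) [IsMonHom f],
        AbelianVariety.Hom.conjugate σ (fibreHom f s) ≫ (e B).hom = (e A).hom ≫ fibreHom f (specTwist σ ≫ s) :=
  ⟨fun A => A.conjFibreIso σ s, fun A τ => A.map_conjFibreIso_conjPoints_restrictPt σ s τ,
    fun _ _ f _ => conjugate_fibreHom_comp_conjFibreIso_hom σ s f⟩

end Conjugate

/-! ## §2 The Frobenius-moved fibre with its structures -/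

section Frobenius

variable {k : Type u} [Field k] [Finite k] {S : SchemeOver k} {A B : AbelianSchemeOver S.left} {L : Type u} [Field L]
  [Algebra k L] (p r : ℕ) [ExpChar L p] [PerfectRing L p]

/-- **The homomorphism square at the Frobenius-moved point — Shimura's «`β^f`».**  For a homomorphism `f : A → B` of
abelian schemes over the `k`-scheme `S` (`#k = q = p^r`), a perfect field `L ⊇ k` and `x : Spec L → S` over `k`, the fibre
of `f` at the moved point `x ≫ F_S` and the Frobenius twist `(f_x)^{(q)}` (★ `Hom.frobeniusTwist`) of its fibre at `x`
correspond under the (d1) identifications `A_{x ≫ F_S} ≅ (A_x)^{(q)}`, `B_{x ≫ F_S} ≅ (B_x)^{(q)}`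
(★ `fibreFrobeniusTwistIso`): `f_{x ≫ F_S} ≫ e_B = e_A ≫ (f_x)^{(q)}`.  With (d1)'s section reading this is the statement
that the moduli tuple at `F(x̄)` is `(A_x̄^{(q)}, ι^{(q)}, λ^{(q)}, F_{A_x̄/L} ∘ η_x̄)`.
[cite: Shimura1998, §18.6 proof of Thm. 18.6, p. 127] [cite: Milne2025, VI §13 Rem. 13.5]
[cite: Milne2005ShimuraVarieties, §14 pp. 124–125] -/
theorem fibreHom_comp_fibreFrobeniusTwistIso_hom (hq : Nat.card k = p ^ r) (x : specOver k L ⟶ S) (f : A.X ⟶ B.X)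
    [IsMonHom f] :
    fibreHom f (x ≫ frobeniusOver S).left ≫ (B.fibreFrobeniusTwistIso p r hq x).hom =
      (A.fibreFrobeniusTwistIso p r hq x).hom ≫ AbelianVariety.Hom.frobeniusTwist p r (fibreHom f x.left) := by
  rw [AbelianVariety.Hom.frobeniusTwist_eq_conjugate]
  simp only [fibreFrobeniusTwistIso, Iso.trans_hom, Iso.symm_hom]
  rw [← Category.assoc, fibreHom_comp_fibreCongrPtIso_hom, Category.assoc, fibreHom_comp_conjFibreIso_inv,
    Category.assoc]

/-- Inverse form: `(f_x)^{(q)} ≫ e_B⁻¹ = e_A⁻¹ ≫ f_{x ≫ F_S}`. [cite: Shimura1998, §18.6 proof of Thm. 18.6, p. 127] -/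
theorem frobeniusTwist_fibreHom_comp_fibreFrobeniusTwistIso_inv (hq : Nat.card k = p ^ r) (x : specOver k L ⟶ S)
    (f : A.X ⟶ B.X) [IsMonHom f] :
    AbelianVariety.Hom.frobeniusTwist p r (fibreHom f x.left) ≫ (B.fibreFrobeniusTwistIso p r hq x).inv =
      (A.fibreFrobeniusTwistIso p r hq x).inv ≫ fibreHom f (x ≫ frobeniusOver S).left := by
  rw [Iso.comp_inv_eq, Category.assoc, Iso.eq_inv_comp, fibreHom_comp_fibreFrobeniusTwistIso_hom]

/-- **Endomorphism form — «`π ∘ β = β^f ∘ π`» read on the fibres: the structure `ι^{(q)}` of `A_x̄^{(q)}`.**  For an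
endomorphism `g` of the abelian scheme `A` (e.g. `g = ι(a)` of an `𝒪`-action, ★ `RingAction.i`), its fibre at the moved
point is the Frobenius twist of its fibre at `x`, transported: `g_{x ≫ F_S} = e_A ≫ (g_x)^{(q)} ≫ e_A⁻¹`
(`(g_x)^{(q)} = endFrobeniusTwist p r _ (g_x)`, ★ `endFrobeniusTwist_apply`).
[cite: Shimura1998, §18.6 proof of Thm. 18.6, p. 127] [cite: Milne2025, VI §13 Rem. 13.5] -/
theorem fibreHom_frobeniusOver_eq_conj (hq : Nat.card k = p ^ r) (x : specOver k L ⟶ S) (g : A.X ⟶ A.X) [IsMonHom g] :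
    fibreHom g (x ≫ frobeniusOver S).left =
      (A.fibreFrobeniusTwistIso p r hq x).hom ≫ AbelianVariety.Hom.frobeniusTwist p r (fibreHom g x.left) ≫
        (A.fibreFrobeniusTwistIso p r hq x).inv := by
  rw [← Category.assoc, Iso.eq_comp_inv, fibreHom_comp_fibreFrobeniusTwistIso_hom]

/-- **Points form**: for an `Ω`-valued point `Q` of the fibre `A_{x ≫ F_S}` (`Ω` any field over `L`),
`e_B(f_{x ≫ F_S}(Q)) = (f_x)^{(q)}(e_A(Q))`. [cite: Shimura1998, §18.6 proof of Thm. 18.6, p. 128]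
[cite: Milne2005ShimuraVarieties, §11 p. 108] -/
theorem map_fibreFrobeniusTwistIso_map_fibreHom (hq : Nat.card k = p ^ r) (x : specOver k L ⟶ S) (f : A.X ⟶ B.X)
    [IsMonHom f] {Ω : Type u} [Field Ω] [Algebra L Ω] (Q : AlgPoints (A.fibre (x ≫ frobeniusOver S).left).toAbelianVariety.X Ω) :
    AlgPoints.map (B.fibreFrobeniusTwistIso p r hq x).hom.hom.hom.hom
        (AlgPoints.map (fibreHom f (x ≫ frobeniusOver S).left).hom.hom.hom Q) =
      AlgPoints.map (AbelianVariety.Hom.frobeniusTwist p r (fibreHom f x.left)).hom.hom.hom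
        (AlgPoints.map (A.fibreFrobeniusTwistIso p r hq x).hom.hom.hom.hom Q) := by
  change (Q ≫ (fibreHom f (x ≫ frobeniusOver S).left).hom.hom.hom) ≫ (B.fibreFrobeniusTwistIso p r hq x).hom.hom.hom.hom =
    (Q ≫ (A.fibreFrobeniusTwistIso p r hq x).hom.hom.hom.hom) ≫
      (AbelianVariety.Hom.frobeniusTwist p r (fibreHom f x.left)).hom.hom.hom
  have h := congrArg (fun φ => φ.hom.hom.hom) (fibreHom_comp_fibreFrobeniusTwistIso_hom p r hq x f)
  simp only [AbelianVariety.comp_hom] at h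
  rw [Category.assoc, Category.assoc]
  exact congrArg (fun ψ => Q ≫ ψ) h

/-- **Def-free natural packaging for consumers (DICT (c3a))**: there is ONE family of isomorphisms
`e_A : A_{x ≫ F_S} ≅ (A_x)^{(q)}`, indexed by the abelian schemes `A` over `S`, which (i) carries the value at the moved
point of every section `τ` of `A → S` to `F_{A_x/L}(τ(x))` (★ (d1) `map_fibreFrobeniusTwistIso_restrictPt`) and (ii) is
natural in `A` for homomorphisms of abelian schemes: the fibre of a tuple `(A, ι, λ, η)` at `F(x̄)` IS the Frobenius
twist `(A_x̄^{(q)}, ι^{(q)}, λ^{(q)}, F_{A_x̄/L} ∘ η_x̄)` of its fibre at `x̄`.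
[cite: Shimura1998, §18.6 proof of Thm. 18.6, pp. 127–128] [cite: Milne2025, VI §13 Rem. 13.5]
[cite: Milne2005ShimuraVarieties, §14 pp. 124–125] -/
theorem exists_iso_fibre_frobeniusOver_natural (hq : Nat.card k = p ^ r) (x : specOver k L ⟶ S) :
    ∃ e : ∀ A : AbelianSchemeOver S.left,
        (A.fibre (x ≫ frobeniusOver S).left).toAbelianVariety ≅ ((A.fibre x.left).toAbelianVariety).frobeniusTwist p r,
      (∀ (A : AbelianSchemeOver S.left) (τ : A.Sections), AlgPoints.map (e A).hom.hom.hom.hom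
          (A.restrictPt (x ≫ frobeniusOver S).left τ) =
        AlgPoints.map ((A.fibre x.left).toAbelianVariety.relFrobenius p r).hom.hom.hom (A.restrictPt x.left τ)) ∧
      ∀ (A B : AbelianSchemeOver S.left) (f : A.X ⟶ B.X) [IsMonHom f],
        fibreHom f (x ≫ frobeniusOver S).left ≫ (e B).hom =
          (e A).hom ≫ AbelianVariety.Hom.frobeniusTwist p r (fibreHom f x.left) :=
  ⟨fun A => A.fibreFrobeniusTwistIso p r hq x, fun A τ => A.map_fibreFrobeniusTwistIso_restrictPt p r hq x τ,
    fun _ _ f _ => fibreHom_comp_fibreFrobeniusTwistIso_hom p r hq x f⟩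

end Frobenius

end AbelianSchemeOver

end Literature.AlgebraicGeometry.AbelianSchemes

end
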